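import Summits.ResolutionOfSingularities.ResolutionOfSingularities.Theorems.WildConesCampaignW46ThreefoldsCharTwoSplittingRegime
import Summits.ResolutionOfSingularities.ResolutionOfSingularities.Theorems.WildConesCampaignW46ThreefoldsCharTwoFamily

/-!
# [OURS · L1 W4.6, rung (ii) at p = 2] The SIDEWAYS EXIT: the Fermat cubic double point
# `z² = u₀³ + u₁³ + u₂³` (isolated, cleaned order 3) has an order-2-cleaned but NON-ISOLATED double point
# among its point-blow-up successors — the other side of the dichotomy is inhabited, over EVERY field of
# characteristic 2

Cell res-hironaka (LADDER-RESOLUTION rung L, D-0089), slot W4.6, seat res-L1-s46-pv-4 (gen 2); host route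
`WildCones`, crux `ClassicalRegimes` (stmt-ResolutionOfSingularities-16884). Companion (non-vacuity / boundary
marker) of `…CharTwoSplittingRegime` (p479260): its dichotomy `threefold_isol_step_iff_ordP` says that an
isolated double state whose successor is a double point has an ISOLATED successor iff the state is order-2
cleaned. The order-2-cleaned side is inhabited by the family `z² = u₀u₁ + u₂^(2j+1)` (p470498). THIS file
inhabits the other side: an ISOLATED double point of cleaned order `3` with a double-point successor, which is
then (by the dichotomy) NOT isolated — the forced (point-blow-up) regime is left SIDEWAYS, into a curve of
double points, where the typed procedure must choose one-dimensional centres: outside route WildCones'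
dynamics and outside rung (ii)@p=2 as banked by this seat. HONEST BOUNDARY of the rung, kernel-checked.

HONEST FRAMING. Everything here is OURS: theorems about route WildCones' own typed point-blow-up dynamics
(`Theorems/WildConesClassicalRegimesDefs.lean`). NOTHING here is a statement of H. Hironaka's manuscript
[Hironaka2017]; no FACT-LIST premise. AI review is weaker than expert review.

THE EXAMPLE (any field `κ` of characteristic `2`). `a = u₀³ + u₁³ + u₂³`: cleaned (no square monomials),
multiplicity two, NOT order-2 cleaned (no quadratic monomial), ISOLATED (`∂a = (u₀², u₁², u₂²) ⊇ 𝔪⁴`, the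
cone over the smooth Fermat cubic; `μ = 8`). Blow up, chart `u₀`, translate to the point `u₁ = 1, u₂ = 0` of
the exceptional plane (a point of the Fermat cubic): `a∘Φ = u₀³(1 + (u₁+1)³ + u₂³) = u₀² · G` with
`G = u₀u₁ + u₀u₁² + u₀u₁³ + u₀u₂³` (characteristic two!), unchanged by cleaning: a double point (`MultP`),
order-2 cleaned (`u₀u₁`), and — by the dichotomy — NOT isolated (indeed `G = u₀ · (…)` is singular along a
curve).

* `coeff_fermat`, `fermat_coeff_eq_zero_of_even`, `multP_of_ser_eq_fermat`, `not_ordP_of_ser_eq_fermat`,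
  `pderiv_fermat`, `maximalIdeal_pow_four_le_span_sq`, `isol_of_ser_eq_fermat` — the start state.
* `subst_blowFam_fermat`, `coeff_fermatStep`, `ser_step_of_ser_eq_fermat`, `multP_step_fermat`,
  `ordP_step_fermat`, `not_isol_step_fermat` — the step.
* `threefold_exists_sidewaysExit` — THE WITNESS: `∃ c i τ, Isol c ∧ MultP c ∧ ¬ OrdP c ∧ MultP c' ∧ OrdP c' ∧
  ¬ Isol c'` for `c' = step i τ c`, over every field of characteristic `2`.
-/

noncomputable section

-- single-problem summit: the doubled namespace component `ResolutionOfSingularities` is forced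
set_option linter.dupNamespace false

open scoped BigOperators Classical

open MvPowerSeries IsLocalRing

open Literature.AlgebraicGeometry.Resolution

namespace Summit.ResolutionOfSingularities.ResolutionOfSingularities.Theorems

namespace CampaignW46.ThreefoldsCharTwo

open WildCones WildCones.MuDropCharTwoOrdP

variable {κ : Type} [Field κ]

/-! ## The Fermat cubic `u₀³ + u₁³ + u₂³` as a cleaned state -/

/-- Coefficients of `X₀³ + X₁³ + X₂³`. [folklore] -/
theorem coeff_fermat (A : Fin 3 →₀ ℕ) :
    coeff A ((X 0 ^ 3 + X 1 ^ 3 + X 2 ^ 3 : MvPowerSeries (Fin 3) κ)) =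
      (if A = Finsupp.single 0 3 then 1 else 0) + (if A = Finsupp.single 1 3 then 1 else 0) +
        (if A = Finsupp.single 2 3 then 1 else 0) := by
  rw [map_add, map_add, X_pow_eq, X_pow_eq, X_pow_eq, coeff_monomial, coeff_monomial, coeff_monomial]

/-- `X₀³ + X₁³ + X₂³` has no monomial with all exponents even (cleaning fixes it). [folklore] -/
theorem fermat_coeff_eq_zero_of_even (A : Fin 3 →₀ ℕ) (hA : ∀ j, 2 ∣ A j) :
    coeff A ((X 0 ^ 3 + X 1 ^ 3 + X 2 ^ 3 : MvPowerSeries (Fin 3) κ)) = 0 := by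
  rw [coeff_fermat]
  have h : ∀ s : Fin 3, A ≠ Finsupp.single s 3 := by
    rintro s rfl
    have := hA s
    rw [Finsupp.single_eq_same] at this
    omega
  rw [if_neg (h 0), if_neg (h 1), if_neg (h 2), add_zero, add_zero]

/-- `X₀³ + X₁³ + X₂³ ≠ 0`. [folklore] -/
theorem fermat_ne_zero : (X 0 ^ 3 + X 1 ^ 3 + X 2 ^ 3 : MvPowerSeries (Fin 3) κ) ≠ 0 := by
  intro h
  have h1 := congrArg (coeff (Finsupp.single (0 : Fin 3) 3)) h
  rw [coeff_fermat, if_pos rfl, map_zero] at h1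
  have h01 : (Finsupp.single (0 : Fin 3) 3 : Fin 3 →₀ ℕ) ≠ Finsupp.single 1 3 := by
    intro h'; have := DFunLike.congr_fun h' 0; simp at this
  have h02 : (Finsupp.single (0 : Fin 3) 3 : Fin 3 →₀ ℕ) ≠ Finsupp.single 2 3 := by
    intro h'; have := DFunLike.congr_fun h' 0; simp at this
  rw [if_neg h01, if_neg h02, add_zero, add_zero] at h1
  exact one_ne_zero h1

/-- `ord (X₀³ + X₁³ + X₂³) ≥ 3`. [folklore] -/
theorem three_le_order_fermat :
    ((3 : ℕ) : ℕ∞) ≤ ((X 0 ^ 3 + X 1 ^ 3 + X 2 ^ 3 : MvPowerSeries (Fin 3) κ)).order := by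
  refine nat_le_order fun d hd => ?_
  rw [coeff_fermat]
  have h : ∀ s : Fin 3, d ≠ Finsupp.single s 3 := by
    rintro s rfl
    rw [Finsupp.degree_single] at hd
    omega
  rw [if_neg (h 0), if_neg (h 1), if_neg (h 2), add_zero, add_zero]

/-- [OURS · L1 W4.6] A state with cleaned series `u₀³ + u₁³ + u₂³` is a double point (`MultP`: non-zero of
order `≥ 2`). [folklore] -/
theorem multP_of_ser_eq_fermat {c : (Fin 3 → ℕ) → κ}
    (hc : ser 2 3 κ c = X 0 ^ 3 + X 1 ^ 3 + X 2 ^ 3) : MultP 2 3 κ c := by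
  rw [multP_iff_ser, hc]
  refine ⟨fermat_ne_zero, le_trans ?_ three_le_order_fermat⟩
  exact_mod_cast (by norm_num : (2 : ℕ) ≤ 3)

/-- [OURS · L1 W4.6] A state with cleaned series `u₀³ + u₁³ + u₂³` is NOT order-2 cleaned (no quadratic
monomial at all). [folklore] -/
theorem not_ordP_of_ser_eq_fermat {c : (Fin 3 → ℕ) → κ}
    (hc : ser 2 3 κ c = X 0 ^ 3 + X 1 ^ 3 + X 2 ^ 3) : ¬ OrdP 2 3 κ c := by
  rw [ordP_two_iff_exists_pair]
  rintro ⟨j, l, -, hq⟩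
  apply hq
  rw [hc, coeff_fermat]
  have h : ∀ s : Fin 3, (Finsupp.single j 1 + Finsupp.single l 1 : Fin 3 →₀ ℕ) ≠ Finsupp.single s 3 := by
    intro s h'
    have := congrArg Finsupp.degree h'
    rw [map_add, Finsupp.degree_single, Finsupp.degree_single, Finsupp.degree_single] at this
    omega
  rw [if_neg (h 0), if_neg (h 1), if_neg (h 2), add_zero, add_zero]

/-- In characteristic two, `∂ₛ (X₀³ + X₁³ + X₂³) = Xₛ²` (`3 = 1`). [folklore] -/
theorem pderiv_fermat [CharP κ 2] (s : Fin 3) :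
    MvPowerSeries.pderiv s ((X 0 ^ 3 + X 1 ^ 3 + X 2 ^ 3 : MvPowerSeries (Fin 3) κ)) = X s ^ 2 := by
  have h3 : (3 : MvPowerSeries (Fin 3) κ) = 1 := by
    rw [show (3 : MvPowerSeries (Fin 3) κ) = 2 + 1 by norm_num, ← map_ofNat (C : κ →+* _) 2,
      CharTwo.two_eq_zero, map_zero, zero_add]
  rw [map_add, map_add, Derivation.leibniz_pow, Derivation.leibniz_pow, Derivation.leibniz_pow,
    MvPowerSeries.pderiv_X, MvPowerSeries.pderiv_X, MvPowerSeries.pderiv_X]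
  fin_cases s <;> simp [smul_eq_mul, h3]

/-- `𝔪⁴ ≤ (X₀², X₁², X₂²)` in `κ⟦X₀,X₁,X₂⟧`: a monomial of degree `4` in three variables has some
exponent `≥ 2`. [folklore] -/
theorem maximalIdeal_pow_four_le_span_sq :
    maximalIdeal (MvPowerSeries (Fin 3) κ) ^ 4 ≤
      Ideal.span (Set.range fun s : Fin 3 => (X s : MvPowerSeries (Fin 3) κ) ^ 2) := by
  rw [Literature.RingTheory.MvPowerSeries.Jets.maximalIdeal_pow_eq_span_monomial, Ideal.span_le]
  rintro _ ⟨e, he, rfl⟩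
  -- some exponent is `≥ 2`
  obtain ⟨s, hs⟩ : ∃ s : Fin 3, 2 ≤ e s := by
    by_contra h
    push Not at h
    have hsum : e.degree = e 0 + e 1 + e 2 := by
      rw [degree_eq_sum_univ, Fin.sum_univ_three]
    have := h 0; have := h 1; have := h 2
    change e.degree = 4 at he
    omega
  have hdec : (monomial e (1 : κ) : MvPowerSeries (Fin 3) κ) =
      monomial (e - Finsupp.single s 2) (1 : κ) * X s ^ 2 := by
    rw [X_pow_eq, monomial_mul_monomial, one_mul, tsub_add_cancel_of_le]
    intro t
    by_cases hts : t = s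
    · subst hts; rwa [Finsupp.single_eq_same]
    · rw [Finsupp.single_apply, if_neg (Ne.symm hts)]; exact Nat.zero_le _
  change (monomial e (1 : κ) : MvPowerSeries (Fin 3) κ) ∈ _
  rw [hdec]
  exact Ideal.mul_mem_left _ _ (Ideal.subset_span ⟨s, rfl⟩)

/-- [OURS · L1 W4.6] **The Fermat cubic double point is ISOLATED** (characteristic two): the Jacobian ideal
of a state with cleaned series `u₀³ + u₁³ + u₂³` is `(u₀², u₁², u₂²) ⊇ 𝔪⁴`, so the Milnor algebra is finite
(the cone over the smooth plane Fermat cubic; `μ = 8`). [folklore] -/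
theorem isol_of_ser_eq_fermat [CharP κ 2] {c : (Fin 3 → ℕ) → κ}
    (hc : ser 2 3 κ c = X 0 ^ 3 + X 1 ^ 3 + X 2 ^ 3) : Isol 2 3 κ c := by
  rw [isol_iff_finite_pderiv, hc]
  have hrange : (Set.range fun s : Fin 3 =>
      MvPowerSeries.pderiv s ((X 0 ^ 3 + X 1 ^ 3 + X 2 ^ 3 : MvPowerSeries (Fin 3) κ))) =
      Set.range fun s : Fin 3 => (X s : MvPowerSeries (Fin 3) κ) ^ 2 := by
    congr 1; funext s; exact pderiv_fermat s
  rw [hrange]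
  haveI := Literature.RingTheory.MvPowerSeries.Jets.finite_quotient_maximalIdeal_pow
    (σ := Fin 3) (K := κ) 4
  exact Module.Finite.of_surjective
    (Ideal.Quotient.factorₐ κ maximalIdeal_pow_four_le_span_sq).toLinearMap
    (Ideal.Quotient.factor_surjective maximalIdeal_pow_four_le_span_sq)

/-! ## One step: chart `u₀`, translation to the point `(u₁, u₂) = (1, 0)` of the exceptional plane -/

/-- The blow-up substitution `Φ_{0,(0,1,0)}` (`X₀ ↦ X₀`, `X₁ ↦ X₀(X₁ + 1)`, `X₂ ↦ X₀X₂`) on the Fermat cubic,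
in characteristic two: `X₀³ + X₀³(X₁+1)³ + X₀³X₂³ = X₀² · (X₀X₁ + X₀X₁² + X₀X₁³ + X₀X₂³)`. [folklore] -/
theorem subst_blowFam_fermat [CharP κ 2] :
    subst (fun s => if s = (0 : Fin 3) then (X 0 : MvPowerSeries (Fin 3) κ)
        else X 0 * (X s + C ((fun s : Fin 3 => if s = 1 then (1 : κ) else 0) s)))
      ((X 0 ^ 3 + X 1 ^ 3 + X 2 ^ 3 : MvPowerSeries (Fin 3) κ)) =
      X 0 ^ 2 * (X 0 * X 1 + X 0 * X 1 ^ 2 + X 0 * X 1 ^ 3 + X 0 * X 2 ^ 3) := by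
  have ha := hasSubst_blowFam (κ := κ) (0 : Fin 3) (fun s : Fin 3 => if s = 1 then (1 : κ) else 0)
  rw [subst_add ha, subst_add ha, subst_pow ha, subst_pow ha, subst_pow ha, subst_X ha, subst_X ha,
    subst_X ha]
  rw [if_pos rfl, if_neg (show (1 : Fin 3) ≠ 0 by decide), if_neg (show (2 : Fin 3) ≠ 0 by decide)]
  simp only [if_true, show (2 : Fin 3) ≠ 1 by decide, if_false, map_one, map_zero, add_zero]
  have h2 : (2 : MvPowerSeries (Fin 3) κ) = 0 := by
    rw [← map_ofNat (C : κ →+* _) 2, CharTwo.two_eq_zero, map_zero]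
  linear_combination (X 0 ^ 3 * ((X 1 : MvPowerSeries (Fin 3) κ) ^ 2 + X 1 + 1)) * h2

/-- Coefficients of the successor series `X₀X₁ + X₀X₁² + X₀X₁³ + X₀X₂³`. [folklore] -/
theorem coeff_fermatStep (A : Fin 3 →₀ ℕ) :
    coeff A ((X 0 * X 1 + X 0 * X 1 ^ 2 + X 0 * X 1 ^ 3 + X 0 * X 2 ^ 3 : MvPowerSeries (Fin 3) κ)) =
      (if A = Finsupp.single 0 1 + Finsupp.single 1 1 then 1 else 0) +
        (if A = Finsupp.single 0 1 + Finsupp.single 1 2 then 1 else 0) +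
        (if A = Finsupp.single 0 1 + Finsupp.single 1 3 then 1 else 0) +
        (if A = Finsupp.single 0 1 + Finsupp.single 2 3 then 1 else 0) := by
  rw [map_add, map_add, map_add, X_pow_eq, X_pow_eq, X_pow_eq, X_def, X_def, monomial_mul_monomial,
    monomial_mul_monomial, monomial_mul_monomial, monomial_mul_monomial, one_mul,
    coeff_monomial, coeff_monomial, coeff_monomial, coeff_monomial]

/-- The successor series has no monomial with all exponents even (every monomial has `u₀`-exponent `1`),
so cleaning fixes it. [folklore] -/
theorem fermatStep_coeff_eq_zero_of_even (A : Fin 3 →₀ ℕ) (hA : ∀ j, 2 ∣ A j) :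
    coeff A ((X 0 * X 1 + X 0 * X 1 ^ 2 + X 0 * X 1 ^ 3 + X 0 * X 2 ^ 3 : MvPowerSeries (Fin 3) κ)) = 0 := by
  rw [coeff_fermatStep]
  have h : ∀ (s : Fin 3) (k : ℕ), s ≠ 0 → A ≠ Finsupp.single 0 1 + Finsupp.single s k := by
    rintro s k hs rfl
    have := hA 0
    rw [Finsupp.add_apply, Finsupp.single_eq_same, Finsupp.single_apply, if_neg hs, add_zero] at this
    omega
  rw [if_neg (h 1 1 (by decide)), if_neg (h 1 2 (by decide)), if_neg (h 1 3 (by decide)),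
    if_neg (h 2 3 (by decide))]
  simp

/-- [OURS · L1 W4.6] **The step on the Fermat cubic**: over any field of characteristic `2`, the successor
of a state with cleaned series `u₀³ + u₁³ + u₂³` in chart `u₀` at the translation `(u₁, u₂) ↦ (u₁ + 1, u₂)`
has cleaned series `u₀u₁ + u₀u₁² + u₀u₁³ + u₀u₂³`. [folklore] -/
theorem ser_step_of_ser_eq_fermat [CharP κ 2] {c : (Fin 3 → ℕ) → κ}
    (hc : ser 2 3 κ c = X 0 ^ 3 + X 1 ^ 3 + X 2 ^ 3) :
    ser 2 3 κ (step 2 3 κ 0 (fun s : Fin 3 => if s = 1 then (1 : κ) else 0) c) =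
      X 0 * X 1 + X 0 * X 1 ^ 2 + X 0 * X 1 ^ 3 + X 0 * X 2 ^ 3 := by
  have hM : MultP 2 3 κ c := multP_of_ser_eq_fermat hc
  have key := X_pow_mul_serT_eq_subst c 0 (fun s : Fin 3 => if s = 1 then (1 : κ) else 0) hM
  rw [hc, subst_blowFam_fermat] at key
  have hX0 : (X 0 : MvPowerSeries (Fin 3) κ) ≠ 0 := fun h => by
    have h1 := congrArg (coeff (Finsupp.single (0 : Fin 3) 1)) h
    rw [coeff_index_single_self_X, map_zero] at h1
    exact one_ne_zero h1
  have hT := mul_left_cancel₀ (pow_ne_zero 2 hX0) key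
  ext A
  rw [coeff_ser_step c 0 _ hM A]
  have hTA : tr 3 κ 0 (fun s : Fin 3 => if s = 1 then (1 : κ) else 0) 2
      (dv 3 κ 0 2 (bl 3 κ 0 (clean 2 3 κ c))) ⇑A =
      coeff A ((X 0 * X 1 + X 0 * X 1 ^ 2 + X 0 * X 1 ^ 3 + X 0 * X 2 ^ 3 : MvPowerSeries (Fin 3) κ)) := by
    rw [← hT]; rfl
  have clean_apply : ∀ (g : (Fin 3 → ℕ) → κ) (B : Fin 3 → ℕ),
      clean 2 3 κ g B = @ite κ (∀ j, 2 ∣ B j) (Classical.dec _) 0 (g B) := fun _ _ => rfl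
  rw [clean_apply]
  by_cases h : ∀ j, 2 ∣ (⇑A) j
  · rw [if_pos h, fermatStep_coeff_eq_zero_of_even A h]
  · rw [if_neg h, hTA]

/-- The pair coefficient `[u₀u₁]` of the successor series is `1`. [folklore] -/
theorem coeff_pair_fermatStep :
    coeff (Finsupp.single 0 1 + Finsupp.single 1 1)
      ((X 0 * X 1 + X 0 * X 1 ^ 2 + X 0 * X 1 ^ 3 + X 0 * X 2 ^ 3 : MvPowerSeries (Fin 3) κ)) = 1 := by
  rw [coeff_fermatStep, if_pos rfl]
  have h : ∀ (s : Fin 3) (k : ℕ), 2 ≤ k →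
      (Finsupp.single 0 1 + Finsupp.single 1 1 : Fin 3 →₀ ℕ) ≠ Finsupp.single 0 1 + Finsupp.single s k := by
    intro s k hk h'
    have := congrArg Finsupp.degree h'
    simp only [map_add, Finsupp.degree_single] at this
    omega
  rw [if_neg (h 1 2 le_rfl), if_neg (h 1 3 (by norm_num)), if_neg (h 2 3 (by norm_num))]
  simp

/-- [OURS · L1 W4.6] The successor of the Fermat cubic state is a DOUBLE POINT. [folklore] -/
theorem multP_step_fermat [CharP κ 2] {c : (Fin 3 → ℕ) → κ}
    (hc : ser 2 3 κ c = X 0 ^ 3 + X 1 ^ 3 + X 2 ^ 3) :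
    MultP 2 3 κ (step 2 3 κ 0 (fun s : Fin 3 => if s = 1 then (1 : κ) else 0) c) := by
  rw [multP_iff_ser, ser_step_of_ser_eq_fermat hc]
  constructor
  · intro h
    have h1 := congrArg (coeff (Finsupp.single (0 : Fin 3) 1 + Finsupp.single 1 1)) h
    rw [coeff_pair_fermatStep, map_zero] at h1
    exact one_ne_zero h1
  · refine nat_le_order fun d hd => ?_
    rw [coeff_fermatStep]
    have h : ∀ (s : Fin 3) (k : ℕ), 1 ≤ k → d ≠ Finsupp.single 0 1 + Finsupp.single s k := by
      rintro s k hk rfl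
      simp only [map_add, Finsupp.degree_single] at hd
      omega
    rw [if_neg (h 1 1 le_rfl), if_neg (h 1 2 (by norm_num)), if_neg (h 1 3 (by norm_num)),
      if_neg (h 2 3 (by norm_num))]
    simp

/-- [OURS · L1 W4.6] The successor of the Fermat cubic state is ORDER-2 CLEANED (`u₀u₁`). [folklore] -/
theorem ordP_step_fermat [CharP κ 2] {c : (Fin 3 → ℕ) → κ}
    (hc : ser 2 3 κ c = X 0 ^ 3 + X 1 ^ 3 + X 2 ^ 3) :
    OrdP 2 3 κ (step 2 3 κ 0 (fun s : Fin 3 => if s = 1 then (1 : κ) else 0) c) := by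
  rw [ordP_two_iff_exists_pair, ser_step_of_ser_eq_fermat hc]
  exact ⟨0, 1, by decide, by rw [coeff_pair_fermatStep]; exact one_ne_zero⟩

/-- [OURS · L1 W4.6; NOT a statement of the manuscript] The successor of the Fermat cubic state is NOT
ISOLATED — by the dichotomy `threefold_not_isol_step_of_not_ordP` (p479260): a double successor of a double
state of cleaned order `≥ 3` never is. (Directly: `G = u₀ · (u₁ + u₁² + u₁³ + u₂³)` is singular along the
curve `u₀ = 0 = u₁ + u₁² + u₁³ + u₂³`.) [folklore] -/
theorem not_isol_step_fermat [CharP κ 2] {c : (Fin 3 → ℕ) → κ}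
    (hc : ser 2 3 κ c = X 0 ^ 3 + X 1 ^ 3 + X 2 ^ 3) :
    ¬ Isol 2 3 κ (step 2 3 κ 0 (fun s : Fin 3 => if s = 1 then (1 : κ) else 0) c) :=
  threefold_not_isol_step_of_not_ordP c 0 _ (multP_of_ser_eq_fermat hc) (not_ordP_of_ser_eq_fermat hc)
    (multP_step_fermat hc)

/-! ## The witness -/

/-- [OURS · L1 W4.6 rung (ii) at `p = 2`, HONEST BOUNDARY of the rung; NOT a statement of the manuscript]
**THE SIDEWAYS EXIT EXISTS.** Over EVERY field of characteristic `2` there is an ISOLATED double point `c`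
of the threefold `z² = a(u₀,u₁,u₂)` of cleaned order `3` (the Fermat cubic cone `a = u₀³ + u₁³ + u₂³`) and
a chart/translation whose successor `c'` is an ORDER-2-CLEANED DOUBLE POINT that is NOT ISOLATED: the
point-blow-up procedure leaves the forced regime sideways, into a curve of double points — the side of the
dichotomy `threefold_isol_step_iff_ordP` opposite to the hyperbolic-splitting regime is inhabited. Route
WildCones' dynamics (point blow-ups) says nothing further there; the typed procedure would need a
one-dimensional centre. [folklore] -/
theorem threefold_exists_sidewaysExit (κ : Type) [Field κ] [CharP κ 2] :
    ∃ (c : (Fin 3 → ℕ) → κ) (i : Fin 3) (τ : Fin 3 → κ),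
      Isol 2 3 κ c ∧ MultP 2 3 κ c ∧ ¬ OrdP 2 3 κ c ∧
        MultP 2 3 κ (step 2 3 κ i τ c) ∧ OrdP 2 3 κ (step 2 3 κ i τ c) ∧ ¬ Isol 2 3 κ (step 2 3 κ i τ c) := by
  obtain ⟨c, hc⟩ := exists_ser_eq (κ := κ) ((X 0 ^ 3 + X 1 ^ 3 + X 2 ^ 3 : MvPowerSeries (Fin 3) κ))
    fermat_coeff_eq_zero_of_even
  exact ⟨c, 0, fun s => if s = 1 then 1 else 0, isol_of_ser_eq_fermat hc, multP_of_ser_eq_fermat hc,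
    not_ordP_of_ser_eq_fermat hc, multP_step_fermat hc, ordP_step_fermat hc, not_isol_step_fermat hc⟩

end CampaignW46.ThreefoldsCharTwo

end Summit.ResolutionOfSingularities.ResolutionOfSingularities.Theorems

end
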